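import Summits.QuantumFields.BalabanUV.T4Continuum.Support.B13ReadingsAvgTowerSecondUniform
import Summits.QuantumFields.BalabanUV.T4Continuum.Support.B13ReadingsAvgTowerSecondBavg

/-!
# B13ReadingsAvgTowerSecondBavgUniform — row NE5, junction J-avg-reg SECOND ORDER (R60), abstract half, file 5: letter (ℓ4) `hbavgD` of
# `NE2FromNE3BavgBridge.localRate_regClass_of_bavg_consistent`, k-UNIFORM ON THE LEVEL WINDOW `k < Kf`, for an averaging tower given by
# `FactorisationData` (file `B13ReadingsAvgTowerUniform`) whose lines START IN THE BLOCK (`st k μ i = cpt i.1 + off (j₀ k μ i)`) and the two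
# second-order letters `SecondOrderLetters` (file `B13ReadingsAvgTowerSecondUniform`): `‖bavg (dconnTower R (k+1) μ) y − dconnTower R k μ y‖
# ≤ γD∕lev L k` with `γD = (2d+2)·βD + (4∕3)·(κ₁ + (2α′ + 9κ)(2β′ + 16κ))`, `βD = 2(β″ + 16β′²) + 8(κ₁ + 9κ(2β′ + 16κ))`

Cell `pub-balaban`, unit `b2b-balaban-t4-ne5-p1` (row NE5 OWNER, gen 40; owner item «g40-σ» FILE B2, INTENT `HOME/CLAIMS.log` l.25382; T4-DAG
Q52; RULING R60; GAPS § G-ne5p1-Javg-reg UPDATE 1).  Summits-side NEW WORK under the LEAN PLACEMENT RULE: [folklore] bookkeeping on the ABSTRACT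
towers of rows NE2 ∕ B5; 0 `def`, no `Prop`-valued fact, nothing printed asserted, no citation tag.  HONEST FRAMING: rung (B)+1 of the
FINITE-VOLUME T⁴ programme — NOT infinite volume, NOT a mass gap, NOT the Clay problem, NOT a proof of NE5 (NOT PRINTED; GAPS G-t4-U3-1), NOT a
proof of NE2; the letters (α′, β′, κ, β″, κ₁) are hypotheses — their instances on Bałaban's (0.4) objects are the substrate's W-25b ∕ W-28 and
the NE5 swarm's κ- and σ-chains, NOT made here.  WINDOW: the abstract data carry NO structure at or above `Kf`, so (ℓ4) is produced for
`k < Kf` only — exactly the substrate's `levelWindow` binder shape (`k + 1 ≤ K`; F-TOP ruling R1).  HONEST DEPENDENCY (cell, verbatim):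
continuum YM on T⁴ ⇐ BetaPertH ∧ nine spine estimates (0/9 proved); BetaPertH ⇐ (D1) ∧ (D4) ∧ CAP+tail; G-an2-4 gates asym, D1 and NE2/3/4.

WHAT.  `hbavgD_of_factorisation`: `B13ReadingsAvgTowerSecondBavg.bavgD_consistent_of_corrLines` at every `k < Kf`, fed by
`regularTransporters_of_factorisation` (α = 2α′+8κ, β = 2β′+16κ), the structure at `y` and at `τ_μ⁻¹ y` (`start_shift`), `corr`,
`corr_shift`, and (ℓ2) at level `k+1` = `B13ReadingsAvgTowerSecondUniform.hlipD_of_factorisation`; then `e^{α∕ℓ} ≤ 4∕3`, `1∕ℓ ≤ 1`.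
WITH THIS FILE the abstract half of J-avg-reg is COMPLETE at both orders: (ℓ1) `regularTransporters_of_factorisation`, (ℓ2)
`hlipD_of_factorisation`, (ℓ3) `B13ReadingsAvgTowerDirect.hbavg_of_corrLines`, (ℓ4) `hbavgD_of_factorisation`.
0 sorry; axioms ⊆ {propext, Classical.choice, Quot.sound}.
-/

noncomputable section

open scoped BigOperators Matrix Matrix.Norms.L2Operator

namespace Summit.QuantumFields.BalabanUV.T4Continuum.B13ReadingsAvgTowerSecondBavgUniform

open Literature.MathematicalPhysics.QuantumFieldTheory.Balaban1983to89.B5Prop11Plancherel (fine Tor unitVec)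
open Literature.MathematicalPhysics.QuantumFieldTheory.Balaban1983to89.B5Block118 (tstep)
open Literature.MathematicalPhysics.QuantumFieldTheory.Balaban1983to89.B5G183RateTorus (cpt)
open Literature.MathematicalPhysics.QuantumFieldTheory.Balaban1983to89.B5G183RateTorusW (off)
open Literature.MathematicalPhysics.QuantumFieldTheory.Balaban1983to89.B5G183RateUnitTower (lev lev_neZero)
open Summit.QuantumFields.BalabanUV.T4Continuum.BalabanAveragedTowerUnit (idx one_le_lev' cast_lev' lev_succ')
open Summit.QuantumFields.BalabanUV.T4Continuum.BlockPairingGeometry (tau)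
open Summit.QuantumFields.BalabanUV.T4Continuum.AbelianCovariantLaplacian (tauInv tau_tauInv tauInv_tau)
open Summit.QuantumFields.BalabanUV.T4Continuum.CovariantLinePlanting (bavg)
open Summit.QuantumFields.BalabanUV.T4Continuum.RegularBackgroundTower (RegularTransporters connTower dconnTower)
open Summit.QuantumFields.BalabanUV.T4Continuum.B13ReadingsLineProducts (lprod)
open Summit.QuantumFields.BalabanUV.T4Continuum.B13ReadingsAvgTowerUniform (FactorisationData regularTransporters_of_factorisation)
open Summit.QuantumFields.BalabanUV.T4Continuum.B13ReadingsAvgTowerSecondUniform (SecondOrderLetters hlipD_of_factorisation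
  exp_le_four_thirds)
open Summit.QuantumFields.BalabanUV.T4Continuum.B13ReadingsAvgTowerSecondBavg (bavgD_consistent_of_corrLines)

variable {d : ℕ} (L : ℕ) [NeZero L] (M : Fin d → ℕ) [hM : ∀ μ, NeZero (M μ)]
variable {o : Type*} [Fintype o] [DecidableEq o]
variable {R S : (k : ℕ) → Fin d → (idx L M k → Matrix o o ℂ)}
variable {st : (k : ℕ) → Fin d → idx L M k → Tor (fine (L * lev L k) M)} {Cf : (k : ℕ) → Fin d → idx L M k → Matrix o o ℂ}
variable {Kf : ℕ} {α' β' κ β'' κ₁ : ℝ}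
variable (hD : FactorisationData L M R S st Cf Kf α' β' κ) (h2 : SecondOrderLetters L M S Cf Kf β'' κ₁)

include hD h2

omit hM in
/-- [folklore] **END — (ℓ4) `hbavgD` ON THE LEVEL WINDOW `k < Kf`, k-UNIFORM** (the `hbavgD` binder of
`NE2FromNE3BavgBridge.localRate_regClass_of_bavg_consistent` ∕ the substrate's windowed `hloc`, for the averaging tower `R`): with the lines of
the averaging structure starting IN THE BLOCK (`st k μ i = cpt i.1 + off (j₀ k μ i)`),
`‖bavg (dconnTower R (k+1) μ) y − dconnTower R k μ y‖ ≤ γD∕lev L k` for every `k < Kf`, where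
`γD = (2d+2)·(2(β″ + 16β′²) + 8(κ₁ + 9κ(2β′ + 16κ))) + (4∕3)·(κ₁ + (2α′ + 9κ)(2β′ + 16κ))`
(`α′ ≤ 1∕16`, `κ ≤ 1∕64`, `2 ≤ L`, `0 ≤ β′, β″, κ, κ₁`). -/
theorem hbavgD_of_factorisation {j₀ : (k : ℕ) → Fin d → idx L M k → (Fin d → Fin L)}
    (hst : ∀ k, k < Kf → ∀ μ (i : idx L M k), st k μ i = cpt (lev L k) L M i.1 + off (lev L k) L M (j₀ k μ i))
    (hL : 2 ≤ L) (hα0 : 0 ≤ α') (hα : α' ≤ 1 / 16) (hβ0 : 0 ≤ β') (hβ''0 : 0 ≤ β'') (hκ0 : 0 ≤ κ) (hκ : κ ≤ 1 / 64) (hκ₁0 : 0 ≤ κ₁) :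
    ∀ k, k < Kf → ∀ (μ : Fin d) (y : idx L M k),
      ‖bavg (lev L k) L M (dconnTower L M R (k + 1) μ) y - dconnTower L M R k μ y‖
        ≤ ((2 * d + 2) * (2 * (β'' + 16 * β' ^ 2) + 8 * (κ₁ + 9 * κ * (2 * β' + 16 * κ)))
            + 4 / 3 * (κ₁ + (2 * α' + 9 * κ) * (2 * β' + 16 * κ))) / (lev L k : ℕ) := by
  intro k hk μ y
  have hℓ1 : (1 : ℝ) ≤ (lev L k : ℕ) := by exact_mod_cast one_le_lev' L k
  have hℓ0 : (0 : ℝ) < (lev L k : ℕ) := by linarith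
  have hRT := regularTransporters_of_factorisation L M hD hL hα0 hα hβ0 hκ0 hκ
  -- the two structures: at `y` (line starting in the block) and at `τ_μ⁻¹ y` (the line `L` fine steps back)
  have hst' : st k μ (tauInv (fine (lev L k) M) μ y) = st k μ y - tstep (fine (L * lev L k) M) μ L := by
    have h := hD.start_shift k μ μ (tauInv (fine (lev L k) M) μ y)
    rw [tau_tauInv] at h
    rw [h, add_sub_cancel_right]
  have hstruct : R k μ y = Cf k μ y * lprod (fun t => R (k + 1) μ
      (cpt (lev L k) L M y.1 + off (lev L k) L M (j₀ k μ y) + tstep (fine (L * lev L k) M) μ t, y.2)) L := by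
    have h := hD.averaging k hk μ y; rw [hst k hk] at h; exact h
  have hstruct'' : R k μ (tauInv (fine (lev L k) M) μ y) = Cf k μ (tauInv (fine (lev L k) M) μ y) * lprod (fun t => R (k + 1) μ
      (cpt (lev L k) L M y.1 + off (lev L k) L M (j₀ k μ y) - tstep (fine (L * lev L k) M) μ L + tstep (fine (L * lev L k) M) μ t, y.2)) L := by
    have h := hD.averaging k hk μ (tauInv (fine (lev L k) M) μ y); rw [hst', hst k hk] at h; exact h
  have hC'' := hD.corr k hk μ (tauInv (fine (lev L k) M) μ y)
  have hCC : ‖Cf k μ y - Cf k μ (tauInv (fine (lev L k) M) μ y)‖ ≤ κ₁ / ((lev L k : ℕ) : ℝ) ^ 3 := by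
    have h := h2.corr_shift k hk μ μ (tauInv (fine (lev L k) M) μ y); rw [tau_tauInv] at h; exact h
  have hlipD' : ∀ (ν : Fin d) (y' : idx L M (k + 1)), ‖dconnTower L M R (k + 1) μ (tau (fine (lev L (k + 1)) M) ν y')
      - dconnTower L M R (k + 1) μ y'‖ ≤ (2 * (β'' + 16 * β' ^ 2) + 8 * (κ₁ + 9 * κ * (2 * β' + 16 * κ))) / (lev L (k + 1) : ℕ) :=
    fun ν y' => hlipD_of_factorisation L M hD h2 hL hα0 hα hβ0 hβ''0 hκ0 hκ hκ₁0 (k + 1) μ ν y'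
  have hmain := bavgD_consistent_of_corrLines L M hRT hstruct hstruct'' hC'' hCC hlipD'
  refine hmain.trans (div_le_div_of_nonneg_right (add_le_add le_rfl ?_) hℓ0.le)
  -- `e^{α∕ℓ}(κ₁ + κβ∕ℓ + αβ) ≤ (4∕3)(κ₁ + (κ + α)β)` with `α = 2α′ + 8κ ≤ 1∕4`, `β = 2β′ + 16κ`
  have hx0 : 0 ≤ (2 * α' + 8 * κ) / ((lev L k : ℕ) : ℝ) := by positivity
  have hx1 : (2 * α' + 8 * κ) / ((lev L k : ℕ) : ℝ) ≤ 1 / 4 := (div_le_self (by positivity) hℓ1).trans (by linarith)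
  have hexp := exp_le_four_thirds hx0 hx1
  have hβ₁ : 0 ≤ 2 * β' + 16 * κ := by positivity
  have hin : κ₁ + κ * (2 * β' + 16 * κ) / ((lev L k : ℕ) : ℝ) + (2 * α' + 8 * κ) * (2 * β' + 16 * κ)
      ≤ κ₁ + (2 * α' + 9 * κ) * (2 * β' + 16 * κ) := by
    have h1 : κ * (2 * β' + 16 * κ) / ((lev L k : ℕ) : ℝ) ≤ κ * (2 * β' + 16 * κ) := div_le_self (by positivity) hℓ1
    nlinarith
  have hnn : 0 ≤ κ₁ + κ * (2 * β' + 16 * κ) / ((lev L k : ℕ) : ℝ) + (2 * α' + 8 * κ) * (2 * β' + 16 * κ) := by positivity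
  exact mul_le_mul hexp hin hnn (by norm_num)

end Summit.QuantumFields.BalabanUV.T4Continuum.B13ReadingsAvgTowerSecondBavgUniform

end
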